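import Mathlib
import Summits.Ventures.HodgeRepro.Tier4.Line1.RTFSetting
import Summits.Ventures.HodgeRepro.Tier4.Line1.InnerCalculus

/-!
# Tier4/Line1/RightTranslationInner — right translation is unitary for `S.inner` on invariant functions

Blind re-derivation cell `pub-hodge-repro`, Tier 4 «prove the step» (README §9–§10), seat t4-L4-p1 (cross-line J1 glue,
lead S12599).  Tree path `lean/Summits/Ventures/HodgeRepro/Tier4/Line1/RightTranslationInner.lean`.  Mathlib-level.

WHAT IS PROVED.  For left-`G(k)`-invariant `ψ, w` the right translate pairs by the inverse translate:
`S.inner (ψ(· g)) w = S.inner ψ (w(· g⁻¹))` (`inner_right_translate`).  Proof: the integrand `x ↦ ψ(xg) conj w(x)` is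
`H(xg)` for the invariant `H(y) = ψ(y) conj w(y g⁻¹)`; the right-invariance of `μ` moves the integral to the translated
fundamental domain `DG · g` (`setIntegral_mul_right`), which is again a fundamental domain of the left action
(`IsFundamentalDomain.image_of_equiv`), and `IsFundamentalDomain.setIntegral_eq` returns to `DG`.

HC_CM is NOT proved by anyone in this repository.
-/

set_option autoImplicit false

noncomputable section

namespace Summit.Ventures.HodgeRepro.Tier4.Line1

open MeasureTheory Topology
open scoped ComplexConjugate

namespace RTF

variable {G : Type} [Group G] [TopologicalSpace G] [IsTopologicalGroup G] [MeasurableSpace G]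
  [BorelSpace G]

namespace Setting

variable (S : Setting G)

/-- The translated fundamental domain `DG · g` is a fundamental domain of the left `G(k)`-action. -/
theorem isFundamentalDomain_image_mul_right (g : G) :
    IsFundamentalDomain S.Gk ((fun x => x * g) '' S.DG) S.μ := by
  haveI := S.rightInv
  have h := S.fdG.image_of_equiv (Equiv.mulRight g) (measurePreserving_mul_right S.μ g⁻¹).quasiMeasurePreserving
    (Equiv.refl S.Gk) (fun γ x => by
      simp only [Equiv.refl_apply, Equiv.coe_mulRight, Subgroup.smul_def, smul_eq_mul]
      group)
  simpa using h

/-- Right translation of the set integral: `∫_{DG} H(xg) = ∫_{DG·g} H`. -/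
theorem setIntegral_mul_right (H : G → ℂ) (g : G) :
    ∫ x in S.DG, H (x * g) ∂S.μ = ∫ y in (fun x => x * g) '' S.DG, H y ∂S.μ := by
  haveI := S.rightInv
  have hind : ∀ x, S.DG.indicator (fun x => H (x * g)) x = ((fun x => x * g) '' S.DG).indicator H (x * g) := by
    intro x
    by_cases hx : x ∈ S.DG
    · rw [Set.indicator_of_mem hx, Set.indicator_of_mem (Set.mem_image_of_mem _ hx)]
    · rw [Set.indicator_of_notMem hx, Set.indicator_of_notMem]
      rintro ⟨y, hy, hyx⟩
      exact hx (mul_right_cancel hyx ▸ hy)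
  have hnm : NullMeasurableSet ((fun x => x * g) '' S.DG) S.μ := by
    have := (isFundamentalDomain_image_mul_right S g).nullMeasurableSet
    exact this
  rw [← integral_indicator₀ S.fdG.nullMeasurableSet, ← integral_indicator₀ hnm,
    ← integral_mul_right_eq_self (((fun x => x * g) '' S.DG).indicator H) g]
  exact integral_congr_ae (Filter.Eventually.of_forall hind)

/-- **Right translation is unitary on invariant functions**: `S.inner (ψ(· g)) w = S.inner ψ (w(· g⁻¹))`. -/
theorem inner_right_translate [SecondCountableTopology G] {ψ w : G → ℂ} (hψ : S.Invariant ψ) (hw : S.Invariant w)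
    (g : G) : S.inner (fun x => ψ (x * g)) w = S.inner ψ (fun x => w (x * g⁻¹)) := by
  haveI := S.haar
  haveI : Countable S.Gk := S.countable_Gk
  unfold inner
  -- the invariant integrand `H(y) = ψ(y) conj w(y g⁻¹)`
  set H : G → ℂ := fun y => ψ y * conj (w (y * g⁻¹)) with hH
  have hHinv : ∀ (γ : S.Gk) (y : G), H ((γ : G) • y) = H y := by
    intro γ y
    simp only [hH, smul_eq_mul]
    rw [hψ γ y, mul_assoc, hw γ (y * g⁻¹)]
  have h1 : (fun x => ψ (x * g) * conj (w x)) = fun x => H (x * g) := by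
    funext x
    simp only [hH, mul_assoc, mul_inv_cancel, mul_one]
  rw [h1, setIntegral_mul_right S H g]
  exact (isFundamentalDomain_image_mul_right S g).setIntegral_eq S.fdG fun γ y => hHinv γ y

end Setting

end RTF

end Summit.Ventures.HodgeRepro.Tier4.Line1

end
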